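import Literature.Analysis.FluidPDE.BiotSavartIdentities
import HarnessLib

/-!
# The tensor `𝒟f = -∇f - ∇fᵀ + 2(div f) Id` of Coiculescu–Palasek and the identity
# `div 𝒟f = curl curl f` (Def. 3.4, Rmk. 3.11)

Analysis/FluidPDE support file (one definition with proved API; no named facts) on the discharge
path of the named fact `Literature.Barriers.NavierStokesRegularity.CoiculescuPalasek2025_principalParts`.
M. P. Coiculescu, S. Palasek, *Non-uniqueness of smooth solutions of the Navier–Stokes equations from
critical data*, Invent. Math. 244 (2025), arXiv:2503.14699, **Def. 3.4**: "the differential operator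
that takes vector fields to fields of symmetric rank-2 tensors, `𝒟f ≔ -∇f - ∇fᵀ + 2(div f) Id`";
"One readily sees that `𝒟` has the property `div 𝒟f = curl curl f`"; **Rmk. 3.11**: "The operator
`curl curl = -Δ + ∇div` has the advantage that `v_k = curl curl ψ_k` is both divergence-free and of
the form `v_k = div 𝒟ψ_k` where `𝒟ψ_k` is a symmetric tensor. The latter property is essential for
our eventual use of [the Nash lemma]." The data iteration (Def. 3.5: the coefficients
`a_{j,k} ∝ Γ_j(Id + c₀ 𝒟ψ⁰_{k-1}/‖𝒟ψ⁰_{k-1}‖_∞)`), Lemma 3.6, Prop. 3.7, the inverse-cascade parts `v̄_k`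
(Def. 3.10, Rmk. 3.12: `ℙ div(χ_{k+1} 𝒟ψ⁰_k) = curl curl ψ⁰_k`) and the residuals (Prop. 4.1) are all
phrased through `𝒟`.

* `CP25.dTensor f x i j = -(∂ⱼf)ᵢ(x) - (∂ᵢf)ⱼ(x) + 2 δᵢⱼ (div f)(x)` on `T³`, with the accepted
  `Torus.partialDeriv`, `Torus.divergence`; tensors in the Pi type `Fin 3 → Fin 3 → ℝ` (the
  convention of `CP25.nash_lemma` and of `CoiculescuPalasek2025.matrixDiv`);
* `CP25.dTensor_symm` — `𝒟f` is symmetric;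
* `CP25.isSmooth_dTensor_entry` — its entries are smooth for smooth `f`;
* `CP25.sum_partialDeriv_dTensor` — **`(div 𝒟f)ᵢ = ∑ⱼ ∂ⱼ(𝒟f)ᵢⱼ = (∇ div f - Δf)ᵢ = (curl curl f)ᵢ`**
  (`CP25.sum_partialDeriv_dTensor_eq_curl_curl`, through the tree's `BDSV.curl_curl`);
  in particular `div 𝒟f` is divergence free (`BDSV.divergence_curl`).

## Mathlib / tree search

Reused: `BDSV.curl`, `BDSV.curl_curl`, `gradient_divergence_apply`, `gradient_apply'`
(`FluidPDE/BiotSavartIdentities`, `OnsagerBDSVBiotSavart`), `Torus.partialDeriv_add/sub/neg/const_smul`,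
`partialDeriv_apply_coord`, `partialDeriv_comm`, `laplacian_eq_sum_partialDeriv_partialDeriv`
(`FunctionSpaces/Torus*`). `lean search 'dTensor|symGrad.*Tensor|-∇f - ∇f'`: nothing prior; the
tree's `Torus.IsEulerReynoldsOn` stress vocabulary uses trace-free symmetric tensors as columns
`𝕋³ → (Fin 3 → ℝ³)`, a different object.

## References

* M. P. Coiculescu, S. Palasek, Invent. Math. 244 (2025) 165–219, doi:10.1007/s00222-025-01396-z,
  arXiv:2503.14699: Def. 3.4, Rmk. 3.11, Rmk. 3.12, Def. 3.5. [CoiculescuPalasek2025]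
-/

noncomputable section

open Set Function UnitAddTorus
open scoped BigOperators

namespace Literature.Analysis.FluidPDE

namespace CP25

open Literature.Analysis.FunctionSpaces Literature.Analysis.FunctionSpaces.Torus BDSV

/-- **Coiculescu–Palasek's tensor `𝒟f = -∇f - ∇fᵀ + 2(div f) Id`** (Def. 3.4) of a vector field on
`T³`: `(𝒟f)ᵢⱼ = -(∂ⱼf)ᵢ - (∂ᵢf)ⱼ + 2δᵢⱼ div f`. [cite: CoiculescuPalasek2025, Def. 3.4] -/
def dTensor (f : UnitAddTorus (Fin 3) → EuclideanSpace ℝ (Fin 3)) (x : UnitAddTorus (Fin 3))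
    (i j : Fin 3) : ℝ :=
  -(Torus.partialDeriv j f x i) - Torus.partialDeriv i f x j +
    2 * (if i = j then Torus.divergence f x else 0)

variable {f : UnitAddTorus (Fin 3) → EuclideanSpace ℝ (Fin 3)}

/-- Unfolding. [folklore] -/
theorem dTensor_apply (f : UnitAddTorus (Fin 3) → EuclideanSpace ℝ (Fin 3)) (x : UnitAddTorus (Fin 3))
    (i j : Fin 3) :
    dTensor f x i j = -(Torus.partialDeriv j f x i) - Torus.partialDeriv i f x j +
      2 * (if i = j then Torus.divergence f x else 0) := rfl

/-- **`𝒟f` is symmetric** ("fields of symmetric rank-2 tensors"). [cite: CoiculescuPalasek2025, Def. 3.4] -/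
theorem dTensor_symm (f : UnitAddTorus (Fin 3) → EuclideanSpace ℝ (Fin 3)) (x : UnitAddTorus (Fin 3))
    (i j : Fin 3) : dTensor f x i j = dTensor f x j i := by
  unfold dTensor
  by_cases h : i = j
  · subst h; ring
  · rw [if_neg h, if_neg (Ne.symm h)]; ring

/-- `𝒟` is homogeneous: `𝒟(c f) = c 𝒟f` for `C¹` `f`. [folklore] -/
theorem dTensor_const_smul (hf : Torus.IsContDiff 1 f) (c : ℝ) (x : UnitAddTorus (Fin 3)) (i j : Fin 3) :
    dTensor (c • f) x i j = c * dTensor f x i j := by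
  unfold dTensor Torus.divergence
  have h1 : ∀ k, Torus.partialDeriv k (c • f) x = c • Torus.partialDeriv k f x := fun k => by
    rw [partialDeriv_const_smul hf c k]; rfl
  have h2 : ∀ k, Torus.partialDeriv k (fun y => (c • f) y k) x = c * Torus.partialDeriv k (fun y => f y k) x := by
    intro k
    rw [partialDeriv_apply_coord (hf.smul c) k x k, partialDeriv_apply_coord hf k x k, h1]
    rfl
  simp_rw [h1, h2, PiLp.smul_apply, smul_eq_mul, ← Finset.mul_sum]
  by_cases h : i = j
  · rw [if_pos h, if_pos h]; ring
  · rw [if_neg h, if_neg h]; ring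

/-- The entries of `𝒟f` are smooth for smooth `f`. [folklore] -/
theorem isSmooth_dTensor_entry (hf : Torus.IsSmooth f) (i j : Fin 3) :
    Torus.IsSmooth (fun y => dTensor f y i j) := by
  have hA : Torus.IsSmooth (fun y => Torus.partialDeriv j f y i) := (hf.partialDeriv j).apply i
  have hB : Torus.IsSmooth (fun y => Torus.partialDeriv i f y j) := (hf.partialDeriv i).apply j
  have hC : Torus.IsSmooth (Torus.divergence f) := hf.divergence
  by_cases h : i = j
  · have hfun : (fun y => dTensor f y i j) =
        fun y => -(Torus.partialDeriv j f y i) - Torus.partialDeriv i f y j + 2 * Torus.divergence f y := by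
      funext y; simp [dTensor, h]
    rw [hfun]
    exact (hA.neg.sub hB).add (hC.smul 2)
  · have hfun : (fun y => dTensor f y i j) =
        fun y => -(Torus.partialDeriv j f y i) - Torus.partialDeriv i f y j := by
      funext y; simp [dTensor, h]
    rw [hfun]
    exact hA.neg.sub hB

/-- The partial derivatives of the entries of `𝒟f`:
`∂ₖ(𝒟f)ᵢⱼ = -(∂ₖ∂ⱼf)ᵢ - (∂ₖ∂ᵢf)ⱼ + 2δᵢⱼ ∂ₖ(div f)` for smooth `f`. [folklore] -/
theorem partialDeriv_dTensor_entry (hf : Torus.IsSmooth f) (i j k : Fin 3) (x : UnitAddTorus (Fin 3)) :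
    Torus.partialDeriv k (fun y => dTensor f y i j) x =
      -(Torus.partialDeriv k (Torus.partialDeriv j f) x i) -
        Torus.partialDeriv k (Torus.partialDeriv i f) x j +
          2 * (if i = j then Torus.partialDeriv k (Torus.divergence f) x else 0) := by
  have hAj : Torus.IsContDiff 1 (Torus.partialDeriv j f) := (hf.partialDeriv j).isContDiff (by simp)
  have hAi : Torus.IsContDiff 1 (Torus.partialDeriv i f) := (hf.partialDeriv i).isContDiff (by simp)
  have hA : Torus.IsContDiff 1 (fun y => Torus.partialDeriv j f y i) :=
    ((hf.partialDeriv j).apply i).isContDiff (by simp)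
  have hB : Torus.IsContDiff 1 (fun y => Torus.partialDeriv i f y j) :=
    ((hf.partialDeriv i).apply j).isContDiff (by simp)
  have hC : Torus.IsContDiff 1 (Torus.divergence f) := hf.divergence.isContDiff (by simp)
  have hnA : Torus.IsContDiff 1 (-(fun y => Torus.partialDeriv j f y i)) := hA.neg
  have hAB : Torus.IsContDiff 1
      ((-(fun y => Torus.partialDeriv j f y i)) - (fun y => Torus.partialDeriv i f y j)) := hnA.sub hB
  have hC2 : Torus.IsContDiff 1 ((2 : ℝ) • Torus.divergence f) := hC.smul 2
  have eA : Torus.partialDeriv k (fun y => Torus.partialDeriv j f y i) x =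
      Torus.partialDeriv k (Torus.partialDeriv j f) x i := partialDeriv_apply_coord hAj k x i
  have eB : Torus.partialDeriv k (fun y => Torus.partialDeriv i f y j) x =
      Torus.partialDeriv k (Torus.partialDeriv i f) x j := partialDeriv_apply_coord hAi k x j
  by_cases h : i = j
  · have hfun : (fun y => dTensor f y i j) =
        (-(fun y => Torus.partialDeriv j f y i)) - (fun y => Torus.partialDeriv i f y j) +
          (2 : ℝ) • Torus.divergence f := by
      funext y; simp [dTensor, h]
    rw [hfun, if_pos h, partialDeriv_add hAB hC2, partialDeriv_sub hnA hB,
      partialDeriv_const_smul hC]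
    simp only [Pi.add_apply, Pi.sub_apply, Pi.smul_apply, smul_eq_mul]
    rw [show (-fun y => Torus.partialDeriv j f y i) = fun y => -Torus.partialDeriv j f y i from rfl,
      partialDeriv_neg, eA, eB]
  · have hfun : (fun y => dTensor f y i j) =
        (-(fun y => Torus.partialDeriv j f y i)) - (fun y => Torus.partialDeriv i f y j) := by
      funext y; simp [dTensor, h]
    rw [hfun, if_neg h, partialDeriv_sub hnA hB]
    simp only [Pi.sub_apply, mul_zero, add_zero]
    rw [show (-fun y => Torus.partialDeriv j f y i) = fun y => -Torus.partialDeriv j f y i from rfl,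
      partialDeriv_neg, eA, eB]

/-- **`div 𝒟f = ∇ div f - Δ f`** in coordinates: `∑ⱼ ∂ⱼ(𝒟f)ᵢⱼ = (∇ div f)ᵢ - (Δf)ᵢ` for smooth `f`
(Schwarz: `∑ⱼ ∂ⱼ∂ᵢfⱼ = ∂ᵢ div f`; `∑ⱼ ∂ⱼ∂ⱼfᵢ = (Δf)ᵢ`). [cite: CoiculescuPalasek2025, Def. 3.4 and Rmk. 3.11] -/
theorem sum_partialDeriv_dTensor (hf : Torus.IsSmooth f) (x : UnitAddTorus (Fin 3)) (i : Fin 3) :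
    ∑ j, Torus.partialDeriv j (fun y => dTensor f y i j) x =
      Torus.gradient (Torus.divergence f) x i - Torus.laplacian f x i := by
  simp_rw [partialDeriv_dTensor_entry hf]
  rw [Finset.sum_add_distrib, Finset.sum_sub_distrib, Finset.sum_neg_distrib]
  -- the Laplacian
  have hlap : Torus.laplacian f x i = ∑ j : Fin 3, Torus.partialDeriv j (Torus.partialDeriv j f) x i := by
    rw [laplacian_eq_sum_partialDeriv_partialDeriv hf]
    simp [Finset.sum_apply]
  -- the gradient of the divergence, twice
  have hgrad : Torus.gradient (Torus.divergence f) x i =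
      ∑ j : Fin 3, Torus.partialDeriv j (Torus.partialDeriv i f) x j := by
    rw [gradient_divergence_apply hf x i]
    refine Finset.sum_congr rfl fun j _ => ?_
    rw [partialDeriv_comm hf i j x]
  have hdiv : ∑ j : Fin 3, (2 : ℝ) * (if i = j then Torus.partialDeriv j (Torus.divergence f) x else 0) =
      2 * Torus.gradient (Torus.divergence f) x i := by
    rw [← Finset.mul_sum, Finset.sum_ite_eq Finset.univ i, if_pos (Finset.mem_univ i),
      gradient_apply' (hf.divergence.isContDiff (by simp)) x i]
  rw [hdiv, ← hlap, ← hgrad]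
  ring

/-- **`div 𝒟f = curl curl f`** (Def. 3.4: "One readily sees that `𝒟` has the property
`div 𝒟f = curl curl f`"; Rmk. 3.11): `∑ⱼ ∂ⱼ(𝒟f)ᵢⱼ = (curl curl f)ᵢ` for smooth `f`, with the tree's
`BDSV.curl`. [cite: CoiculescuPalasek2025, Def. 3.4 and Rmk. 3.11] -/
theorem sum_partialDeriv_dTensor_eq_curl_curl (hf : Torus.IsSmooth f) (x : UnitAddTorus (Fin 3)) (i : Fin 3) :
    ∑ j, Torus.partialDeriv j (fun y => dTensor f y i j) x = curl (curl f) x i := by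
  rw [sum_partialDeriv_dTensor hf x i, curl_curl hf x, PiLp.sub_apply]

end CP25

end Literature.Analysis.FluidPDE
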